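import Literature.Barriers.Parity.SiegelZeroDichotomyPairHLStepTwo
import Literature.NumberTheory.Sieve.PolynomialValuesSieveBounds
import Literature.NumberTheory.LFunctions.SiegelZeroExceptionalPrimesSecond
import HarnessLib

/-!
# Tao–Teräväinen 2022, (5.9) at `k = 2`, `ℓ = 0` — PROVED

Topic `Literature/Barriers/Parity`; a file of the proof DAG of the named fact
`Literature.Barriers.Parity.TaoTeravainen2021_pairHL` (Tao–Teräväinen, *The Hardy–Littlewood–Chowla
conjecture in the presence of a Siegel zero*, J. London Math. Soc. 106 (2022), arXiv:2109.06291,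
Corollary 1.8 (i); see `SiegelZeroDichotomyPairHL.lean`, `…PairHLSiegelModel.lean`,
`…PairHLStepTwo.lean`). It DISCHARGES the named fact
`Literature.Barriers.Parity.TaoTeravainen2021_eq59_pair` of `SiegelZeroDichotomyPairHLStepTwo.lean`
— the bound (5.9) of the proof of Proposition 5.2, "`𝔼_{n ≤ x} G(n+h₁) ∏_{j=2}^k (Λν+G)(n+h_j) ≈ 0`",
at `k = 2`, `ℓ = 0` — as `TaoTeravainen2021_eq59_pair_holds`, with no new named fact (the only
new definition is the polynomial `pairPoly h₁ h₂ = (X + h₁)(X + h₂)` fed to the tree's sieve, and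
the reducible predicate `IsRough`). After this file and `SiegelZeroDichotomyPairHLLemma51.lean` the
inputs of `TaoTeravainen2021_prop52_pair_of_stepTwo` that remain named facts are (5.7) and (5.8)
(`TaoTeravainen2021_eq57_pair`, `_eq58_pair`), whose printed proofs rest on Lemma 3.4.

## What the source prints (arXiv:2109.06291, §5, proof of Proposition 5.2) and how it is formalised

"We begin with (5.9), which is a variant of (4.4). We can bound `(Λν + G)(n+h_j)` by
`O(log(2x) 1_{(≥R^{1/4})}(n+h_j))`, and we also have the bound
`G(n+h₁) ≪ log(2x) ∑_{√(2x) < p* ≤ 2x/R^{1/2}} 1_{p*|n+h₁} 1_{(≥R^{1/4})}(n+h₁)` unless `n+h_j` is of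
the form `p^m` for some `p < R^{1/4}` and `m ≥ 1`, or `p'p^m` … There are only `O(x log x/R^{1/4})`
such exceptional values of `n` and their contribution is easily seen to be negligible using (3.1).
Thus it will suffice to show that
(5.10) `(log^k x) ∑_{√(2x) < p* ≤ 2x/R^{1/2}} 𝔼_{n ≤ x} 1_{p*|n+h₁} ∏_{j=1}^k 1_{(≥R^{1/4})}(n+h_j) ≈ 0`.
Making the change of variables `n = p* n' - h₁` and using Lemma 3.2 and Mertens' theorem (3.5), we
see that `𝔼_{n ≤ x} 1_{p*|n+h₁} ∏_{j=1}^k 1_{(≥R^{1/4})}(n+h_j) ≪ 1/(p* log^k R)`. The claim (5.10)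
now follows from Corollary 3.6 and (2.3)." [cite: TaoTeravainen2021, §5, proof of Proposition 5.2, (5.9)–(5.10)]

Formalisation (`k = 2`, shifts `h₁ ≠ h₂`, `R = x^{1/log^{1/10} η}`, `Λν`, `G` = the tree's
`sievedVonMangoldt`, `errG` of `SiegelZeroDichotomyPairHLStepTwo.lean`):

* Support of `Λν` and `G` (`sievedVonMangoldt_le_ite`, `errG_le_ite`, `errG_le_sum`): with the
  smoothed Selberg sieve `ν` of (2.14) one has `ν(p^j) = 0` for `p ≤ R^{1/2}` exactly
  (`selbergSieve_prime_pow_eq_zero`), so `Λν(m) ≠ 0` forces `m = p^j` with `p > R^{1/2}`; hence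
  `(Λν + G)(m) ≤ 2(1+B)² log(2x) 1_{rough}(m)` and `G(n+h₁) ≤ (1+B)² log(2x) ∑_{p*} 1_{p* ∣ n+h₁}
  1_{rough}(n+h₁)` hold for ALL `n ≤ x` (`|ψ| ≤ B`; "rough" = all prime factors `> R^{1/2}`,
  `IsRough`; at most one prime `> √(2x)` divides a number `≤ 2x`), which makes the exceptional set
  of the printed argument empty — a harmless strengthening of the first reduction. The sum over `p*`
  is restricted to `p* ≤ x` (a non-zero term `Λν((n+h₁)/p*)` needs `(n+h₁)/p* ≥ 2`).
* Reduction to (5.10) (`sum_errG_mul_le`):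
  `∑_{n ≤ x} G(n+h₁)(Λν+G)(n+h₂) ≤ 2((1+B)² log 2x)² ∑_{p*} N(p*)`,
  `N(p*) = #{n ≤ x : p* ∣ n+h₁, n+h₁ and n+h₂ rough}`.
* Lemma 3.2 + Mertens for the pair (`card_filter_rough_pair_le`, `prod_one_sub_rootCount_pairPoly_le`,
  `sum_card_rough_pair_le`): rough numbers are coprime to `P(z)` for `z² ≤ R`, so `N(p*)` is bounded
  by the tree's proved upper-bound sieve for polynomial sequences on a progression,
  `Literature.NumberTheory.Sieve.card_apIndex_coprime_le` (dimension `2`, Fundamental Lemma with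
  explicit constant `C_Ω = flConst 2 (2e^{17+12/log 2})`), applied to `(X + h₁)(X + h₂)` on
  `n ≡ -h₁ (mod p*)` at level `D = z`: `N(p*) ≤ (1 + C_Ω)(x/p*) V(z) + z e⁸ log² z` with
  `V(z) = ∏_{p<z} (1 - ω(p)/p) ≤ 4^{|h₁-h₂|} C₀²/log² z` (`ω(p) = 2` off the prime divisors of
  `h₁ - h₂`, `ω(2) ≤ 1` when `h₁ ≡ h₂ (mod 2)`; Mertens' `∏_{p<z}(1-1/p) ≤ C₀/log z` is the tree's
  `prod_primesBelow_one_sub_inv_le`). If `h₁ ≢ h₂ (mod 2)` every `N(p*)` vanishes (one of `n+h₁`,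
  `n+h₂` is even). The source's change of variables `n = p*n' - h₁` is replaced by sifting the
  progression directly; the sifting level is `z = R^{1/5}` (`≤ R^{1/2}`, and `z ≤ √(2x) < p*`).
* Corollary 3.6 (i) (`sum_inv_excPrimes_le` and the tree's PROVED
  `Literature.NumberTheory.LFunctions.SiegelZero.TaoTeravainen2021_cor36_i_holds`):
  `∑_{√(2x) < p* ≤ x} 1/p* ≤ ∑_{R₀ ≤ p* ≤ x} 1/p* ≤ K exp(-√(log η)/2)` (`R₀ = x^{1/√log η} ≤ √(2x)`).
* Bookkeeping ((2.3) and (1.4)): with `ℓ = log^{1/20} η`, `log x = t ℓ²` where `t = log R`; the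
  main term is `≤ 200 (1+B)⁴ (1+C_Ω) 4^{|h₁-h₂|} C₀² K · ℓ⁴ e^{-ℓ¹⁰/2} ≤ C₁/ℓ` (`ℓ⁵ ≤ e^{ℓ¹⁰/2}`), and
  the sieve error, `#{p*} ≤ 3x/R^{1/2}` terms of size `z e⁸ log² z`, is
  `≤ e⁸ (1+B)⁴ ℓ⁴ t⁴ e^{-3t/10} x ≤ C₂ x/ℓ` using `t ≥ ℓ¹⁸/c_S` — this is where Siegel's bound (1.4)
  `η ≤ C_S q` (tree: `exists_siegelZero_quality_le`, i.e. `log η ≤ c_S log x`,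
  `c_S = 1 + |log C_S|`) enters, giving `log R ≫ log^{0.9} x → ∞`; the source invokes the same
  hierarchy of scales in §2.4. The threshold `η₁` collects `η₀` of Corollary 3.6, `e^{1024}`
  (`R ≤ x^{1/2}`), `exp((10 c_S + 10)^{20})` (`t ≥ 10`, so `z ≥ 3`, `R ≥ 4`) and `C_S max(h₁, h₂)`
  (`x ≥ h₁, h₂`); `ε₁ = 1` (the range (1.7) is used only through `x ≥ q`).

## References

* T. Tao, J. Teräväinen, *The Hardy–Littlewood–Chowla conjecture in the presence of a Siegel zero*,
  J. London Math. Soc. (2) 106 (2022), 3317–3378; arXiv:2109.06291, §2.3–§2.5, Lemma 3.2, (3.5),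
  Corollary 3.6, §5 (proof of Proposition 5.2, (5.9)–(5.10)). [cite: TaoTeravainen2021, §5 (5.9)–(5.10)]
-/

noncomputable section

open Finset
open scoped ArithmeticFunction.vonMangoldt ArithmeticFunction.Moebius

namespace Literature.Barriers.Parity

namespace TaoTeravainen

variable {q : ℕ} (χ : DirichletCharacter ℂ q)

/-! ### `R^{1/2}`-rough numbers and the support of `Λν`, `G` -/

/-- `IsRough R m`: every prime factor `p` of `m` has `p² > R` (all prime factors exceed `R^{1/2}`;
the source's `1_{(≥ R^{1/4})}` is implied). [cite: TaoTeravainen2021, §5 (proof of (5.9))] -/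
abbrev IsRough (R : ℝ) (m : ℕ) : Prop :=
  ∀ p ∈ m.primeFactors, R < (p : ℝ) ^ 2

/-- `ν(p^j) = 0` for a prime `p ≤ R^{1/2}` (`ψ_{≤R}(p) = ψ(log_R p) = 1` as `log_R p ≤ 1/2`).
[cite: TaoTeravainen2021, §2.5 (2.14)] -/
theorem selbergSieve_prime_pow_eq_zero {ψ : ℝ → ℝ} (hψ : IsSmoothCutoff ψ) {R : ℝ} (hR : 1 < R)
    {p : ℕ} (hp : p.Prime) {j : ℕ} (hj : 1 ≤ j) (hpR : (p : ℝ) ^ 2 ≤ R) :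
    selbergSieve ψ R (p ^ j) = 0 := by
  rw [selbergSieve_prime_pow_of_isSmoothCutoff hψ R hp hj]
  have hlogR : 0 < Real.log R := Real.log_pos hR
  have hp1 : (1 : ℝ) ≤ p := by exact_mod_cast hp.one_lt.le
  have hcut : cutoffLE ψ R p = 1 := by
    unfold cutoffLE
    apply hψ.eq_one
    rw [abs_of_nonneg (div_nonneg (Real.log_nonneg hp1) hlogR.le), div_le_iff₀ hlogR]
    have h2 : Real.log ((p : ℝ) ^ 2) ≤ Real.log R := Real.log_le_log (by positivity) hpR
    rw [Real.log_pow] at h2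
    push_cast at h2
    linarith
  rw [hcut]
  norm_num

/-- **The support of `Λν`**: `Λν(m) ≠ 0` forces `m = p^j` with `p > R^{1/2}`, so `m` is
`R^{1/2}`-rough; quantitatively `Λν(m) ≤ (1+B)² log m · 1_{rough}(m)` (`|ψ| ≤ B`).
[cite: TaoTeravainen2021, §5 (proof of (5.9): "`(Λν + G)(n+h_j)` … `O(log(2x) 1_{(≥R^{1/4})}(n+h_j))`")] -/
theorem sievedVonMangoldt_le_ite {ψ : ℝ → ℝ} (hψ : IsSmoothCutoff ψ) {B : ℝ}
    (hB : ∀ u : ℝ, |ψ u| ≤ B) {R : ℝ} (hR : 1 < R) (m : ℕ) :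
    sievedVonMangoldt ψ R m ≤
      (1 + B) ^ 2 * Real.log m * (if IsRough R m then 1 else 0) := by
  have hlog0 : 0 ≤ Real.log (m : ℝ) := Real.log_natCast_nonneg m
  by_cases hpp : IsPrimePow m
  · obtain ⟨p, k, hp, hk, rfl⟩ := (isPrimePow_nat_iff _).mp hpp
    by_cases hpR : R < (p : ℝ) ^ 2
    · have hrough : IsRough R (p ^ k) := by
        intro p' hp'
        rw [Nat.primeFactors_prime_pow hk.ne' hp, Finset.mem_singleton] at hp'
        rw [hp']
        exact hpR
      rw [if_pos hrough, mul_one]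
      exact sievedVonMangoldt_le hψ hB R _
    · push Not at hpR
      unfold sievedVonMangoldt
      rw [selbergSieve_prime_pow_eq_zero hψ hR hp hk hpR, mul_zero]
      split_ifs <;> positivity
  · unfold sievedVonMangoldt
    rw [ArithmeticFunction.vonMangoldt_eq_zero_iff.mpr hpp, zero_mul]
    split_ifs <;> positivity

/-- If `p ∣ m` is a prime with `p² > R` and `m/p` is `R^{1/2}`-rough, so is `m`. [folklore] -/
theorem isRough_of_div {R : ℝ} {m p : ℕ} (hp : p.Prime) (hpm : p ∣ m) (hpR : R < (p : ℝ) ^ 2)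
    (h : IsRough R (m / p)) : IsRough R m := by
  intro p' hp'
  have hm0 : m ≠ 0 := (Nat.mem_primeFactors.mp hp').2.2
  have hp'p : p'.Prime := Nat.prime_of_mem_primeFactors hp'
  have hp'm : p' ∣ p * (m / p) := by
    rw [Nat.mul_div_cancel' hpm]
    exact Nat.dvd_of_mem_primeFactors hp'
  rcases (Nat.Prime.dvd_mul hp'p).mp hp'm with h1 | h1
  · rw [(Nat.prime_dvd_prime_iff_eq hp'p hp).mp h1]
    exact hpR
  · have hmp0 : m / p ≠ 0 := by
      intro h0
      have := Nat.mul_div_cancel' hpm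
      rw [h0, mul_zero] at this
      exact hm0 this.symm
    exact h p' (Nat.mem_primeFactors.mpr ⟨hp'p, h1, hmp0⟩)

/-- At most one prime exceeding `Y^{1/2}` divides a number `0 < m ≤ Y`. [folklore] -/
theorem card_filter_prime_gt_sqrt_dvd_le_one {m : ℕ} (hm : 0 < m) {Y : ℝ} (hmY : (m : ℝ) ≤ Y)
    (s : Finset ℕ) (P : ℕ → Prop) [DecidablePred P] :
    #(s.filter fun p => p.Prime ∧ P p ∧ Real.sqrt Y < p ∧ p ∣ m) ≤ 1 := by
  rw [Finset.card_le_one]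
  intro a ha b hb
  rw [Finset.mem_filter] at ha hb
  by_contra hab
  have hcop : a.Coprime b := (Nat.coprime_primes ha.2.1 hb.2.1).mpr hab
  have hdvd : a * b ∣ m := hcop.mul_dvd_of_dvd_of_dvd ha.2.2.2.2 hb.2.2.2.2
  have hle : ((a * b : ℕ) : ℝ) ≤ m := by exact_mod_cast Nat.le_of_dvd hm hdvd
  push_cast at hle
  have hY0 : 0 ≤ Y := le_trans (Nat.cast_nonneg m) hmY
  have hs : Real.sqrt Y * Real.sqrt Y = Y := Real.mul_self_sqrt hY0
  have hab' : Real.sqrt Y * Real.sqrt Y < (a : ℝ) * b :=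
    mul_lt_mul'' ha.2.2.2.1 hb.2.2.2.1 (Real.sqrt_nonneg Y) (Real.sqrt_nonneg Y)
  linarith

/-- **The support of `G`** ((5.6)): for `1 ≤ m ≤ 2x` and `R ≤ 2x`,
`G(m) ≤ (1+B)² log(2x) · 1_{rough}(m)` — each term `Λν(m/p*)` is `≤ (1+B)² log(2x) 1_{rough}(m/p*)`,
`m = p* · (m/p*)` is then rough (`p*² > 2x ≥ R`), and at most one prime `p* > √(2x)` divides `m`.
[cite: TaoTeravainen2021, §5 (proof of (5.9))] -/
theorem errG_le_ite {ψ : ℝ → ℝ} (hψ : IsSmoothCutoff ψ) {B : ℝ} (hB : ∀ u : ℝ, |ψ u| ≤ B)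
    {R : ℝ} (hR : 1 < R) {x m : ℕ} (hRx : R ≤ 2 * x) (hm : 1 ≤ m) (hmx : m ≤ 2 * x) :
    errG χ ψ R x m ≤ (1 + B) ^ 2 * Real.log (2 * x) * (if IsRough R m then 1 else 0) := by
  have hK0 : 0 ≤ (1 + B) ^ 2 := sq_nonneg _
  have hx0 : (1 : ℝ) ≤ 2 * x := by exact_mod_cast (hm.trans hmx)
  have hlog2x : 0 ≤ Real.log (2 * x) := Real.log_nonneg hx0
  have hmx' : (m : ℝ) ≤ 2 * x := by exact_mod_cast hmx
  unfold errG
  set P := (Finset.range (m + 1)).filter (fun p : ℕ =>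
      p.Prime ∧ realChar χ p ≠ -1 ∧ Real.sqrt (2 * x) < (p : ℝ) ∧ (p : ℝ) ≤ 2 * x / Real.sqrt R ∧
        p ∣ m) with hPdef
  -- each term
  have hterm : ∀ p ∈ P, sievedVonMangoldt ψ R (m / p) ≤
      (1 + B) ^ 2 * Real.log (2 * x) * (if IsRough R m then 1 else 0) := by
    intro p hp
    rw [hPdef, Finset.mem_filter] at hp
    obtain ⟨-, hpp, -, hpsq, -, hpm⟩ := hp
    have hpR : R < (p : ℝ) ^ 2 := by
      have h2x : Real.sqrt (2 * x) ^ 2 = 2 * x := Real.sq_sqrt (by positivity)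
      have : Real.sqrt (2 * x) ^ 2 < (p : ℝ) ^ 2 := by
        exact pow_lt_pow_left₀ hpsq (Real.sqrt_nonneg _) two_ne_zero
      linarith
    have h1 := sievedVonMangoldt_le_ite hψ hB hR (m / p)
    have hlogmp : Real.log ((m / p : ℕ) : ℝ) ≤ Real.log (2 * x) := by
      rcases Nat.eq_zero_or_pos (m / p) with h0 | hpos
      · rw [h0]
        simp [hlog2x]
      · exact Real.log_le_log (by exact_mod_cast hpos)
          (le_trans (by exact_mod_cast Nat.div_le_self m p) hmx')
    by_cases hr : IsRough R (m / p)
    · rw [if_pos hr, mul_one] at h1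
      rw [if_pos (isRough_of_div hpp hpm hpR hr), mul_one]
      exact h1.trans (mul_le_mul_of_nonneg_left hlogmp hK0)
    · rw [if_neg hr, mul_zero] at h1
      refine h1.trans ?_
      split_ifs <;> positivity
  have hcard : #P ≤ 1 := by
    have hsub : P ⊆ (Finset.range (m + 1)).filter (fun p : ℕ =>
        p.Prime ∧ realChar χ p ≠ -1 ∧ Real.sqrt (2 * x) < (p : ℝ) ∧ p ∣ m) := by
      intro p hp
      rw [hPdef, Finset.mem_filter] at hp
      rw [Finset.mem_filter]
      exact ⟨hp.1, hp.2.1, hp.2.2.1, hp.2.2.2.1, hp.2.2.2.2.2⟩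
    exact (Finset.card_le_card hsub).trans
      (card_filter_prime_gt_sqrt_dvd_le_one hm hmx' _ _)
  have hnonneg : 0 ≤ (1 + B) ^ 2 * Real.log (2 * x) * (if IsRough R m then (1 : ℝ) else 0) := by
    split_ifs <;> positivity
  calc ∑ p ∈ P, sievedVonMangoldt ψ R (m / p)
      ≤ ∑ p ∈ P, (1 + B) ^ 2 * Real.log (2 * x) * (if IsRough R m then 1 else 0) :=
        Finset.sum_le_sum hterm
    _ = #P * ((1 + B) ^ 2 * Real.log (2 * x) * (if IsRough R m then 1 else 0)) := by
        rw [Finset.sum_const, nsmul_eq_mul]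
    _ ≤ 1 * ((1 + B) ^ 2 * Real.log (2 * x) * (if IsRough R m then 1 else 0)) := by
        exact mul_le_mul_of_nonneg_right (by exact_mod_cast hcard) hnonneg
    _ = _ := one_mul _

/-- **`G` in terms of the exceptional primes `p* ≤ x`**: for `1 ≤ h ≤ x`, `1 ≤ n ≤ x`, `R ≤ 2x`,
`G(n+h) ≤ (1+B)² log(2x) ∑_{p* ≤ x, √(2x) < p* ≤ 2x/R^{1/2}} 1_{p* ∣ n+h} 1_{rough}(n+h)` (a term
`Λν((n+h)/p*)` is non-zero only if `(n+h)/p* ≥ 2`, whence `p* ≤ (x+h)/2 ≤ x`).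
[cite: TaoTeravainen2021, §5 (proof of (5.9), (5.10))] -/
theorem errG_le_sum {ψ : ℝ → ℝ} (hψ : IsSmoothCutoff ψ) {B : ℝ} (hB : ∀ u : ℝ, |ψ u| ≤ B)
    {R : ℝ} (hR : 1 < R) {x h n : ℕ} (hRx : R ≤ 2 * x) (hh : h ≤ x) (hn1 : 1 ≤ n) (hnx : n ≤ x) :
    errG χ ψ R x (n + h) ≤ (1 + B) ^ 2 * Real.log (2 * x) *
      ∑ p ∈ (Finset.range (x + 1)).filter (fun p : ℕ =>
          p.Prime ∧ realChar χ p ≠ -1 ∧ Real.sqrt (2 * x) < (p : ℝ) ∧ (p : ℝ) ≤ 2 * x / Real.sqrt R),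
        (if p ∣ n + h ∧ IsRough R (n + h) then 1 else 0) := by
  have hK0 : 0 ≤ (1 + B) ^ 2 := sq_nonneg _
  have hm : 1 ≤ n + h := by omega
  have hmx : n + h ≤ 2 * x := by omega
  have hx0 : (1 : ℝ) ≤ 2 * x := by exact_mod_cast (hm.trans hmx)
  have hlog2x : 0 ≤ Real.log (2 * x) := Real.log_nonneg hx0
  have hmx' : ((n + h : ℕ) : ℝ) ≤ 2 * x := by exact_mod_cast hmx
  unfold errG
  set P := (Finset.range (n + h + 1)).filter (fun p : ℕ =>
      p.Prime ∧ realChar χ p ≠ -1 ∧ Real.sqrt (2 * x) < (p : ℝ) ∧ (p : ℝ) ≤ 2 * x / Real.sqrt R ∧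
        p ∣ n + h) with hPdef
  set Q := (Finset.range (x + 1)).filter (fun p : ℕ =>
      p.Prime ∧ realChar χ p ≠ -1 ∧ Real.sqrt (2 * x) < (p : ℝ) ∧ (p : ℝ) ≤ 2 * x / Real.sqrt R)
    with hQdef
  -- terms with `p > x` vanish
  have hvanish : ∀ p ∈ P, x < p → sievedVonMangoldt ψ R ((n + h) / p) = 0 := by
    intro p hp hxp
    have hlt : (n + h) / p < 2 := by
      apply Nat.div_lt_of_lt_mul
      omega
    interval_cases hq : (n + h) / p
    · simp [sievedVonMangoldt]
    · simp [sievedVonMangoldt]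
  have hstep1 : ∑ p ∈ P, sievedVonMangoldt ψ R ((n + h) / p) =
      ∑ p ∈ P.filter (fun p => p ≤ x), sievedVonMangoldt ψ R ((n + h) / p) := by
    symm
    apply Finset.sum_filter_of_ne
    intro p hp hne
    by_contra hpx
    exact hne (hvanish p hp (not_le.mp hpx))
  have hsub : P.filter (fun p => p ≤ x) ⊆ Q.filter (fun p => p ∣ n + h) := by
    intro p hp
    rw [Finset.mem_filter, hPdef, Finset.mem_filter] at hp
    rw [Finset.mem_filter, hQdef, Finset.mem_filter, Finset.mem_range]
    exact ⟨⟨Nat.lt_succ_of_le hp.2, hp.1.2.1, hp.1.2.2.1, hp.1.2.2.2.1, hp.1.2.2.2.2.1⟩,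
      hp.1.2.2.2.2.2⟩
  have hterm : ∀ p ∈ Q.filter (fun p => p ∣ n + h), sievedVonMangoldt ψ R ((n + h) / p) ≤
      (1 + B) ^ 2 * Real.log (2 * x) * (if p ∣ n + h ∧ IsRough R (n + h) then 1 else 0) := by
    intro p hp
    rw [Finset.mem_filter, hQdef, Finset.mem_filter] at hp
    obtain ⟨⟨-, hpp, -, hpsq, -⟩, hpm⟩ := hp
    have hpR : R < (p : ℝ) ^ 2 := by
      have h2x : Real.sqrt (2 * x) ^ 2 = 2 * x := Real.sq_sqrt (by positivity)
      have : Real.sqrt (2 * x) ^ 2 < (p : ℝ) ^ 2 :=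
        pow_lt_pow_left₀ hpsq (Real.sqrt_nonneg _) two_ne_zero
      linarith
    have h1 := sievedVonMangoldt_le_ite hψ hB hR ((n + h) / p)
    have hlogmp : Real.log (((n + h) / p : ℕ) : ℝ) ≤ Real.log (2 * x) := by
      rcases Nat.eq_zero_or_pos ((n + h) / p) with h0 | hpos
      · rw [h0]
        simp [hlog2x]
      · exact Real.log_le_log (by exact_mod_cast hpos)
          (le_trans (by exact_mod_cast Nat.div_le_self (n + h) p) hmx')
    by_cases hr : IsRough R ((n + h) / p)
    · rw [if_pos hr, mul_one] at h1
      rw [if_pos ⟨hpm, isRough_of_div hpp hpm hpR hr⟩, mul_one]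
      exact h1.trans (mul_le_mul_of_nonneg_left hlogmp hK0)
    · rw [if_neg hr, mul_zero] at h1
      refine h1.trans ?_
      split_ifs <;> positivity
  calc ∑ p ∈ P, sievedVonMangoldt ψ R ((n + h) / p)
      = ∑ p ∈ P.filter (fun p => p ≤ x), sievedVonMangoldt ψ R ((n + h) / p) := hstep1
    _ ≤ ∑ p ∈ Q.filter (fun p => p ∣ n + h), sievedVonMangoldt ψ R ((n + h) / p) :=
        Finset.sum_le_sum_of_subset_of_nonneg hsub fun p _ _ => sievedVonMangoldt_nonneg ψ R _
    _ ≤ ∑ p ∈ Q.filter (fun p => p ∣ n + h),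
          (1 + B) ^ 2 * Real.log (2 * x) * (if p ∣ n + h ∧ IsRough R (n + h) then 1 else 0) :=
        Finset.sum_le_sum hterm
    _ ≤ ∑ p ∈ Q, (1 + B) ^ 2 * Real.log (2 * x) *
          (if p ∣ n + h ∧ IsRough R (n + h) then 1 else 0) :=
        Finset.sum_le_sum_of_subset_of_nonneg (Finset.filter_subset _ _) fun p _ _ => by
          split_ifs <;> positivity
    _ = _ := by rw [← Finset.mul_sum]


/-- **Reduction of (5.9) to the counting problem (5.10)**: for `h₁, h₂ ≤ x`, `1 < R ≤ 2x`,
`∑_{n ≤ x} G(n+h₁)(Λν + G)(n+h₂) ≤ 2 ((1+B)² log 2x)² ∑_{p*} #{n ≤ x : p* ∣ n+h₁, n+h₁ and n+h₂ rough}`,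
the sum over the exceptional primes `p* ≤ x` with `√(2x) < p* ≤ 2x/R^{1/2}` ("Thus it will suffice
to show that `(log^k x) ∑_{√(2x) < p* ≤ 2x/R^{1/2}} 𝔼_{n ≤ x} 1_{p*|n+h₁} ∏_j 1_{(≥R^{1/4})}(n+h_j) ≈ 0`").
[cite: TaoTeravainen2021, §5 (proof of (5.9), reduction to (5.10))] -/
theorem sum_errG_mul_le {ψ : ℝ → ℝ} (hψ : IsSmoothCutoff ψ) {B : ℝ} (hB : ∀ u : ℝ, |ψ u| ≤ B)
    {R : ℝ} (hR : 1 < R) {x h₁ h₂ : ℕ} (hRx : R ≤ 2 * x) (hh₁ : h₁ ≤ x) (hh₂ : h₂ ≤ x) :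
    ∑ n ∈ Icc 1 x, errG χ ψ R x (n + h₁) *
        (sievedVonMangoldt ψ R (n + h₂) + errG χ ψ R x (n + h₂)) ≤
      2 * ((1 + B) ^ 2 * Real.log (2 * x)) ^ 2 *
        ∑ p ∈ (Finset.range (x + 1)).filter (fun p : ℕ =>
            p.Prime ∧ realChar χ p ≠ -1 ∧ Real.sqrt (2 * x) < (p : ℝ) ∧
              (p : ℝ) ≤ 2 * x / Real.sqrt R),
          (#((Icc 1 x).filter fun n : ℕ =>
              p ∣ n + h₁ ∧ IsRough R (n + h₁) ∧ IsRough R (n + h₂)) : ℝ) := by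
  set K : ℝ := (1 + B) ^ 2 with hKdef
  set L : ℝ := Real.log (2 * x) with hLdef
  set Q := (Finset.range (x + 1)).filter (fun p : ℕ =>
      p.Prime ∧ realChar χ p ≠ -1 ∧ Real.sqrt (2 * x) < (p : ℝ) ∧ (p : ℝ) ≤ 2 * x / Real.sqrt R)
    with hQdef
  have hK0 : 0 ≤ K := sq_nonneg _
  rcases Nat.eq_zero_or_pos x with rfl | hxpos
  · simp
  have hx1 : (1 : ℝ) ≤ 2 * x := by
    have : (1 : ℝ) ≤ x := by exact_mod_cast hxpos
    linarith
  have hL0 : 0 ≤ L := Real.log_nonneg hx1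
  -- the pointwise bound
  have hpt : ∀ n ∈ Icc 1 x,
      errG χ ψ R x (n + h₁) * (sievedVonMangoldt ψ R (n + h₂) + errG χ ψ R x (n + h₂)) ≤
        2 * (K * L) ^ 2 * ∑ p ∈ Q,
          (if p ∣ n + h₁ ∧ IsRough R (n + h₁) ∧ IsRough R (n + h₂) then (1 : ℝ) else 0) := by
    intro n hn
    rw [Finset.mem_Icc] at hn
    obtain ⟨hn1, hnx⟩ := hn
    have hA := errG_le_sum χ hψ hB hR hRx hh₁ hn1 hnx
    have hA0 : 0 ≤ errG χ ψ R x (n + h₁) := errG_nonneg _ _ _ _ _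
    -- `(Λν + G)(n + h₂) ≤ 2 K L 1_{rough}`
    have hB1 := sievedVonMangoldt_le_ite hψ hB hR (n + h₂)
    have hB2 := errG_le_ite χ hψ hB hR hRx (show 1 ≤ n + h₂ by omega) (show n + h₂ ≤ 2 * x by omega)
    have hlog : Real.log ((n + h₂ : ℕ) : ℝ) ≤ L :=
      Real.log_le_log (by exact_mod_cast (show 0 < n + h₂ by omega))
        (by exact_mod_cast (show n + h₂ ≤ 2 * x by omega))
    have hBB : sievedVonMangoldt ψ R (n + h₂) + errG χ ψ R x (n + h₂) ≤
        2 * K * L * (if IsRough R (n + h₂) then 1 else 0) := by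
      have hι0 : (0 : ℝ) ≤ (if IsRough R (n + h₂) then 1 else 0) := by split_ifs <;> norm_num
      have h1 : (1 + B) ^ 2 * Real.log ((n + h₂ : ℕ) : ℝ) * (if IsRough R (n + h₂) then 1 else 0) ≤
          K * L * (if IsRough R (n + h₂) then 1 else 0) :=
        mul_le_mul_of_nonneg_right (mul_le_mul_of_nonneg_left hlog hK0) hι0
      have h2 : (1 + B) ^ 2 * Real.log (2 * x) * (if IsRough R (n + h₂) then 1 else 0) =
          K * L * (if IsRough R (n + h₂) then 1 else 0) := rfl
      linarith
    have hBB0 : 0 ≤ sievedVonMangoldt ψ R (n + h₂) + errG χ ψ R x (n + h₂) :=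
      add_nonneg (sievedVonMangoldt_nonneg ψ R _) (errG_nonneg _ _ _ _ _)
    have hS0 : 0 ≤ ∑ p ∈ Q, (if p ∣ n + h₁ ∧ IsRough R (n + h₁) then (1 : ℝ) else 0) :=
      Finset.sum_nonneg fun p _ => by split_ifs <;> norm_num
    calc errG χ ψ R x (n + h₁) * (sievedVonMangoldt ψ R (n + h₂) + errG χ ψ R x (n + h₂))
        ≤ (K * L * ∑ p ∈ Q, (if p ∣ n + h₁ ∧ IsRough R (n + h₁) then (1 : ℝ) else 0)) *
            (2 * K * L * (if IsRough R (n + h₂) then 1 else 0)) :=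
          mul_le_mul hA hBB hBB0 (by positivity)
      _ = 2 * (K * L) ^ 2 * ((if IsRough R (n + h₂) then (1 : ℝ) else 0) *
            ∑ p ∈ Q, (if p ∣ n + h₁ ∧ IsRough R (n + h₁) then (1 : ℝ) else 0)) := by ring
      _ = 2 * (K * L) ^ 2 * ∑ p ∈ Q, ((if p ∣ n + h₁ ∧ IsRough R (n + h₁) then (1 : ℝ) else 0) *
            (if IsRough R (n + h₂) then 1 else 0)) := by
          congr 1
          rw [Finset.mul_sum]
          refine Finset.sum_congr rfl fun p _ => ?_
          ring
      _ = 2 * (K * L) ^ 2 * ∑ p ∈ Q,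
            (if p ∣ n + h₁ ∧ IsRough R (n + h₁) ∧ IsRough R (n + h₂) then (1 : ℝ) else 0) := by
          congr 1
          refine Finset.sum_congr rfl fun p _ => ?_
          by_cases h1 : p ∣ n + h₁ ∧ IsRough R (n + h₁)
          · by_cases h2 : IsRough R (n + h₂)
            · rw [if_pos h1, if_pos h2, if_pos ⟨h1.1, h1.2, h2⟩, one_mul]
            · rw [if_neg h2, mul_zero, if_neg fun h => h2 h.2.2]
          · rw [if_neg h1, zero_mul, if_neg fun h => h1 ⟨h.1, h.2.1⟩]
  -- sum over `n` and exchange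
  calc ∑ n ∈ Icc 1 x, errG χ ψ R x (n + h₁) *
          (sievedVonMangoldt ψ R (n + h₂) + errG χ ψ R x (n + h₂))
      ≤ ∑ n ∈ Icc 1 x, 2 * (K * L) ^ 2 * ∑ p ∈ Q,
          (if p ∣ n + h₁ ∧ IsRough R (n + h₁) ∧ IsRough R (n + h₂) then (1 : ℝ) else 0) :=
        Finset.sum_le_sum hpt
    _ = 2 * (K * L) ^ 2 * ∑ p ∈ Q, ∑ n ∈ Icc 1 x,
          (if p ∣ n + h₁ ∧ IsRough R (n + h₁) ∧ IsRough R (n + h₂) then (1 : ℝ) else 0) := by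
        rw [← Finset.mul_sum, Finset.sum_comm]
    _ = 2 * (K * L) ^ 2 * ∑ p ∈ Q, (#((Icc 1 x).filter fun n : ℕ =>
          p ∣ n + h₁ ∧ IsRough R (n + h₁) ∧ IsRough R (n + h₂)) : ℝ) := by
        congr 1
        refine Finset.sum_congr rfl fun p _ => ?_
        rw [Finset.sum_boole]


/-! ### The sieve input: Lemma 3.2 for the pair `(n + h₁)(n + h₂)` on a progression -/

section PairPoly

open Polynomial Literature.NumberTheory.Sieve

/-- The polynomial `(X + h₁)(X + h₂)` whose values are sifted in (5.10). [cite: TaoTeravainen2021, §5 (proof of (5.9))] -/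
def pairPoly (h₁ h₂ : ℕ) : ℤ[X] :=
  (X + C (h₁ : ℤ)) * (X + C (h₂ : ℤ))

/-- `(X + h₁)(X + h₂)` at `n`. [folklore] -/
theorem pairPoly_eval (h₁ h₂ : ℕ) (n : ℤ) :
    (pairPoly h₁ h₂).eval n = (n + h₁) * (n + h₂) := by
  simp [pairPoly]

/-- `(X + h₁)(X + h₂)` is monic. [folklore] -/
theorem pairPoly_monic (h₁ h₂ : ℕ) : (pairPoly h₁ h₂).Monic :=
  (monic_X_add_C _).mul (monic_X_add_C _)

/-- `deg (X + h₁)(X + h₂) = 2`. [folklore] -/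
theorem pairPoly_natDegree (h₁ h₂ : ℕ) : (pairPoly h₁ h₂).natDegree = 2 := by
  rw [pairPoly, (monic_X_add_C _).natDegree_mul (monic_X_add_C _), natDegree_X_add_C,
    natDegree_X_add_C]

/-- `ω(p) ≤ 2` for `(X + h₁)(X + h₂)` (Lagrange). [folklore] -/
theorem polyRootCountMod_pairPoly_le (h₁ h₂ : ℕ) {p : ℕ} (hp : p.Prime) :
    polyRootCountMod ![pairPoly h₁ h₂] p ≤ 2 := by
  have h := polyRootCountMod_single_le_natDegree hp (g := pairPoly h₁ h₂) (by
    rw [(pairPoly_monic h₁ h₂).leadingCoeff]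
    exact_mod_cast Nat.Prime.not_dvd_one hp)
  rwa [pairPoly_natDegree] at h

/-- `ω(2) ≤ 1` for `(X + h₁)(X + h₂)` when `h₁ ≡ h₂ (mod 2)` (then `(n+h₁)(n+h₂) ≡ (n+h₁)²`).
[folklore] -/
theorem polyRootCountMod_pairPoly_two_le (h₁ h₂ : ℕ) (hpar : h₁ % 2 = h₂ % 2) :
    polyRootCountMod ![pairPoly h₁ h₂] 2 ≤ 1 := by
  rw [polyRootCountMod_single, Finset.card_le_one]
  intro a ha b hb
  simp only [Finset.mem_filter, Finset.mem_range, pairPoly_eval] at ha hb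
  have h2 : Prime (2 : ℤ) := Int.prime_two
  have ha' : 2 ∣ a + h₁ ∨ 2 ∣ a + h₂ := by
    rcases h2.dvd_or_dvd ha.2 with h | h
    · left; exact_mod_cast h
    · right; exact_mod_cast h
  have hb' : 2 ∣ b + h₁ ∨ 2 ∣ b + h₂ := by
    rcases h2.dvd_or_dvd hb.2 with h | h
    · left; exact_mod_cast h
    · right; exact_mod_cast h
  omega

/-- `ω(p) ≥ 2` for `(X + h₁)(X + h₂)` at a prime `p ∤ h₁ - h₂` (the roots `-h₁`, `-h₂` are
distinct mod `p`). [folklore] -/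
theorem two_le_polyRootCountMod_pairPoly (h₁ h₂ : ℕ) {p : ℕ} (hp : p.Prime)
    (hndvd : ¬ (p : ℤ) ∣ (h₁ : ℤ) - h₂) : 2 ≤ polyRootCountMod ![pairPoly h₁ h₂] p := by
  haveI : NeZero p := ⟨hp.ne_zero⟩
  rw [← card_polyRootsMod]
  have hsub : ({-(h₁ : ZMod p), -(h₂ : ZMod p)} : Finset (ZMod p)) ⊆
      polyRootsMod (pairPoly h₁ h₂) p := by
    intro x hx
    rw [mem_polyRootsMod]
    simp only [Finset.mem_insert, Finset.mem_singleton] at hx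
    rcases hx with rfl | rfl <;> simp [pairPoly]
  have hne : -(h₁ : ZMod p) ≠ -(h₂ : ZMod p) := by
    intro h
    apply hndvd
    have h' : ((h₁ : ℤ) : ZMod p) = ((h₂ : ℤ) : ZMod p) := by
      rw [Int.cast_natCast, Int.cast_natCast]
      exact neg_injective h
    rw [ZMod.intCast_eq_intCast_iff_dvd_sub] at h'
    exact dvd_sub_comm.mp h'
  calc 2 = #({-(h₁ : ZMod p), -(h₂ : ZMod p)} : Finset (ZMod p)) := (Finset.card_pair hne).symm
    _ ≤ _ := Finset.card_le_card hsub

/-- **The main term of the pair sieve**: `V(z) = ∏_{p < z} (1 - ω(p)/p) ≤ 4^{|h₁-h₂|} C₀²/log² z`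
for `z ≥ 3` (`ω(p) = 2` off the prime divisors of `h₁ - h₂`, so `1 - ω(p)/p ≤ (1 - 1/p)²`, and
Mertens' bound `∏_{p<z} (1 - 1/p) ≤ C₀/log z`, `C₀ = 4e^{6/log 2} log 2` — the tree's
`prod_primesBelow_one_sub_inv_le`). This is "Lemma 3.2 and Mertens' theorem (3.5)" for the pair.
[cite: TaoTeravainen2021, Lemma 3.2 and (3.5)] -/
theorem prod_one_sub_rootCount_pairPoly_le {h₁ h₂ : ℕ} (hne : h₁ ≠ h₂) {z : ℝ} (hz : 3 ≤ z) :
    ∏ p ∈ Nat.primesBelow ⌈z⌉₊, (1 - (polyRootCountMod ![pairPoly h₁ h₂] p : ℝ) / p) ≤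
      4 ^ (Int.natAbs ((h₁ : ℤ) - h₂)) * (4 * Real.exp (6 / Real.log 2) * Real.log 2) ^ 2 /
        Real.log z ^ 2 := by
  set H : ℕ := Int.natAbs ((h₁ : ℤ) - h₂) with hHdef
  have hH0 : H ≠ 0 := by
    rw [hHdef]
    intro h
    rw [Int.natAbs_eq_zero, sub_eq_zero] at h
    exact hne (by exact_mod_cast h)
  set S := Nat.primesBelow ⌈z⌉₊ with hSdef
  set C₀ : ℝ := 4 * Real.exp (6 / Real.log 2) * Real.log 2 with hC₀
  -- termwise comparison
  have hle : ∀ p ∈ S, (1 - (polyRootCountMod ![pairPoly h₁ h₂] p : ℝ) / p) ≤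
      (1 - (p : ℝ)⁻¹) ^ 2 * (if p ∣ H then 4 else 1) := by
    intro p hp
    have hpp : p.Prime := Nat.prime_of_mem_primesBelow hp
    have hp2 : (2 : ℝ) ≤ p := by exact_mod_cast hpp.two_le
    have hp0 : (0 : ℝ) < p := by linarith
    by_cases hpH : p ∣ H
    · rw [if_pos hpH]
      have hω0 : (0 : ℝ) ≤ (polyRootCountMod ![pairPoly h₁ h₂] p : ℝ) / p := by positivity
      have hhalf : (1 : ℝ) / 2 ≤ 1 - (p : ℝ)⁻¹ := by
        rw [inv_eq_one_div]
        have : (1 : ℝ) / p ≤ 1 / 2 := one_div_le_one_div_of_le two_pos hp2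
        linarith
      nlinarith
    · rw [if_neg hpH, mul_one]
      have h2 : (2 : ℝ) ≤ (polyRootCountMod ![pairPoly h₁ h₂] p : ℝ) := by
        exact_mod_cast two_le_polyRootCountMod_pairPoly h₁ h₂ hpp
          (fun h => hpH (Int.natCast_dvd.mp h))
      have : 1 - (polyRootCountMod ![pairPoly h₁ h₂] p : ℝ) / p ≤ 1 - 2 / p := by
        gcongr
      calc 1 - (polyRootCountMod ![pairPoly h₁ h₂] p : ℝ) / p ≤ 1 - 2 / p := this
        _ ≤ (1 - (p : ℝ)⁻¹) ^ 2 := by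
            rw [inv_eq_one_div]
            have h3 : 0 ≤ (1 / (p : ℝ)) ^ 2 := sq_nonneg _
            have h4 : (1 - 1 / (p : ℝ)) ^ 2 = 1 - 2 / p + (1 / (p : ℝ)) ^ 2 := by ring
            linarith
  have h0 : ∀ p ∈ S, 0 ≤ (1 - (polyRootCountMod ![pairPoly h₁ h₂] p : ℝ) / p) := by
    intro p hp
    have hpp : p.Prime := Nat.prime_of_mem_primesBelow hp
    have hp0 : (0 : ℝ) < p := by exact_mod_cast hpp.pos
    rw [sub_nonneg, div_le_one hp0]
    exact_mod_cast polyRootCountMod_le _ p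
  have hprod := Finset.prod_le_prod h0 hle
  rw [Finset.prod_mul_distrib, Finset.prod_pow] at hprod
  -- the factor `∏ (if p ∣ H then 4 else 1) ≤ 4^H`
  have hfac : ∏ p ∈ S, (if p ∣ H then (4 : ℝ) else 1) ≤ 4 ^ H := by
    rw [Finset.prod_ite, Finset.prod_const_one, mul_one, Finset.prod_const]
    refine pow_le_pow_right₀ (by norm_num) ?_
    calc #(S.filter fun p => p ∣ H) ≤ #H.divisors := by
          refine Finset.card_le_card fun p hp => ?_
          rw [Finset.mem_filter] at hp
          exact Nat.mem_divisors.mpr ⟨hp.2, hH0⟩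
      _ ≤ H := Nat.card_divisors_le_self H
  -- Mertens
  have hM := prod_primesBelow_one_sub_inv_le hz
  have hM0 : 0 ≤ ∏ p ∈ S, (1 - (p : ℝ)⁻¹) :=
    Finset.prod_nonneg fun p hp => by
      have hpp : p.Prime := Nat.prime_of_mem_primesBelow hp
      rw [sub_nonneg]
      exact Nat.cast_inv_le_one p
  have hlogz : 0 < Real.log z := Real.log_pos (by linarith)
  have hM2 : (∏ p ∈ S, (1 - (p : ℝ)⁻¹)) ^ 2 ≤ (C₀ / Real.log z) ^ 2 :=
    pow_le_pow_left₀ hM0 hM 2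
  calc ∏ p ∈ S, (1 - (polyRootCountMod ![pairPoly h₁ h₂] p : ℝ) / p)
      ≤ (∏ p ∈ S, (1 - (p : ℝ)⁻¹)) ^ 2 * ∏ p ∈ S, (if p ∣ H then (4 : ℝ) else 1) := hprod
    _ ≤ (C₀ / Real.log z) ^ 2 * 4 ^ H :=
        mul_le_mul hM2 hfac (Finset.prod_nonneg fun p _ => by split_ifs <;> norm_num)
          (sq_nonneg _)
    _ = 4 ^ H * C₀ ^ 2 / Real.log z ^ 2 := by
        rw [div_pow]
        ring

/-- **Lemma 3.2 for the pair on the progression `n ≡ -h₁ (mod p*)`**: for a prime `P ≥ z ≥ 2`,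
`z² ≤ R`, `h₁ ≡ h₂ (mod 2)`:
`#{1 ≤ n ≤ x : P ∣ n + h₁, n + h₁ and n + h₂ R^{1/2}-rough} ≤ (1 + C_Ω)(x/P) V(z) + z e⁸ log² z`
(rough numbers are coprime to `P(z)`; the tree's upper-bound sieve
`Literature.NumberTheory.Sieve.card_apIndex_coprime_le` for `(X + h₁)(X + h₂)` at level `D = z`).
[cite: TaoTeravainen2021, Lemma 3.2 (applied in the proof of (5.9))] -/
theorem card_filter_rough_pair_le {x h₁ h₂ P : ℕ} (hP : P.Prime) (hpar : h₁ % 2 = h₂ % 2)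
    {R z : ℝ} (hz : 2 ≤ z) (hzP : z ≤ P) (hzR : z ^ 2 ≤ R) :
    (#((Icc 1 x).filter fun n : ℕ => P ∣ n + h₁ ∧ IsRough R (n + h₁) ∧ IsRough R (n + h₂)) : ℝ) ≤
      (1 + SieveSequence.flConst 2 (2 * Real.exp (17 + 12 / Real.log 2))) * ((x : ℝ) / P) *
          ∏ p ∈ Nat.primesBelow ⌈z⌉₊, (1 - (polyRootCountMod ![pairPoly h₁ h₂] p : ℝ) / p) +
        z * (Real.exp 8 * Real.log z ^ 2) := by
  -- the residue class
  set r : ℕ := P - h₁ % P with hrdef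
  have hPr : P ∣ r + h₁ := by
    have hmod := Nat.div_add_mod h₁ P
    have hlt : h₁ % P < P := Nat.mod_lt _ hP.pos
    have : r + h₁ = P + P * (h₁ / P) := by
      rw [hrdef]
      omega
    rw [this]
    exact dvd_add dvd_rfl (dvd_mul_right _ _)
  -- inclusion into the sifted progression
  have hsub : ((Icc 1 x).filter fun n : ℕ => P ∣ n + h₁ ∧ IsRough R (n + h₁) ∧ IsRough R (n + h₂)) ⊆
      (apIndex x P r).filter fun n : ℕ =>
        ((pairPoly h₁ h₂).eval (n : ℤ)).natAbs.Coprime (primesProdBelow z) := by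
    intro n hn
    rw [Finset.mem_filter, Finset.mem_Icc] at hn
    obtain ⟨⟨hn1, hnx⟩, hPn, hr1, hr2⟩ := hn
    rw [Finset.mem_filter, mem_apIndex]
    refine ⟨⟨⟨hn1, hnx⟩, ?_⟩, ?_⟩
    · exact Nat.ModEq.add_right_cancel' h₁
        ((Nat.modEq_zero_iff_dvd.mpr hPn).trans (Nat.modEq_zero_iff_dvd.mpr hPr).symm)
    · rw [coprime_primesProdBelow_iff]
      intro p hp hpdvd
      rw [Nat.mem_primesBelow] at hp
      obtain ⟨hpz, hpp⟩ := hp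
      have hpz' : (p : ℝ) < z := Nat.lt_ceil.mp hpz
      have hpR : (p : ℝ) ^ 2 < R := by
        have : (p : ℝ) ^ 2 < z ^ 2 := pow_lt_pow_left₀ hpz' (Nat.cast_nonneg p) two_ne_zero
        linarith
      rw [pairPoly_eval, Int.natAbs_mul] at hpdvd
      have hcast1 : ((n : ℤ) + h₁).natAbs = n + h₁ := by
        rw [show ((n : ℤ) + h₁) = ((n + h₁ : ℕ) : ℤ) by push_cast; ring, Int.natAbs_natCast]
      have hcast2 : ((n : ℤ) + h₂).natAbs = n + h₂ := by
        rw [show ((n : ℤ) + h₂) = ((n + h₂ : ℕ) : ℤ) by push_cast; ring, Int.natAbs_natCast]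
      rw [hcast1, hcast2] at hpdvd
      rcases (Nat.Prime.dvd_mul hpp).mp hpdvd with h | h
      · have := hr1 p (Nat.mem_primeFactors.mpr ⟨hpp, h, by omega⟩)
        linarith
      · have := hr2 p (Nat.mem_primeFactors.mpr ⟨hpp, h, by omega⟩)
        linarith
  have hqz : ∀ p : ℕ, p.Prime → (p : ℝ) < z → ¬ p ∣ P := by
    intro p hp hpz hpP
    have : p = P := (Nat.prime_dvd_prime_iff_eq hp hP).mp hpP
    rw [this] at hpz
    linarith
  have hx : ∀ n ∈ apIndex x P r, 0 < (pairPoly h₁ h₂).eval (n : ℤ) ∧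
      (((pairPoly h₁ h₂).eval (n : ℤ) : ℤ) : ℝ) ≤ ((x : ℝ) + h₁) * ((x : ℝ) + h₂) := by
    intro n hn
    rw [mem_apIndex] at hn
    obtain ⟨⟨hn0, hnx⟩, -⟩ := hn
    rw [pairPoly_eval]
    constructor
    · positivity
    · push_cast
      have hnx' : (n : ℝ) ≤ x := by exact_mod_cast hnx
      have h1 : (0 : ℝ) ≤ (n : ℝ) + h₁ := by positivity
      have h2 : (0 : ℝ) ≤ (n : ℝ) + h₂ := by positivity
      exact mul_le_mul (by linarith) (by linarith) h2 (by positivity)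
  have hmain := card_apIndex_coprime_le (polyRootCountMod_pairPoly_two_le h₁ h₂ hpar)
    (fun p hp => polyRootCountMod_pairPoly_le h₁ h₂ hp) hP.pos hz le_rfl hqz hx
  exact le_trans (by exact_mod_cast Finset.card_le_card hsub) hmain

/-- The odd case: if `h₁ ≢ h₂ (mod 2)`, one of `n + h₁`, `n + h₂` is even (and `≥ 2`), so for
`R ≥ 4` no `n ≥ 1` has both `R^{1/2}`-rough. [folklore] -/
theorem card_filter_rough_pair_eq_zero {x h₁ h₂ P : ℕ} (hpar : h₁ % 2 ≠ h₂ % 2) {R : ℝ}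
    (hR : 4 ≤ R) :
    #((Icc 1 x).filter fun n : ℕ => P ∣ n + h₁ ∧ IsRough R (n + h₁) ∧ IsRough R (n + h₂)) = 0 := by
  rw [Finset.card_eq_zero, Finset.filter_eq_empty_iff]
  intro n hn h
  rw [Finset.mem_Icc] at hn
  obtain ⟨-, hr1, hr2⟩ := h
  have key : ∀ m : ℕ, 1 ≤ m → 2 ∣ m → ¬ IsRough R m := by
    intro m hm h2 hr
    have := hr 2 (Nat.mem_primeFactors.mpr ⟨Nat.prime_two, h2, by omega⟩)
    norm_num at this
    linarith
  rcases Nat.even_or_odd (n + h₁) with h1 | h1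
  · exact key (n + h₁) (by omega) (even_iff_two_dvd.mp h1) hr1
  · have h2 : 2 ∣ n + h₂ := by
      rw [Nat.odd_iff] at h1
      omega
    exact key (n + h₂) (by omega) h2 hr2

end PairPoly

/-! ### The exceptional primes: Corollary 3.6 (i) and the number of `p*` -/

/-- The exceptional primes `p* ≤ x` with `√(2x) < p* ≤ 2x/R^{1/2}` lie in `[R₀, x]` once
`R₀ ≤ √(2x)`, and `Re χ(p) ≠ -1` implies `χ(p) ≠ -1`; hence their reciprocal sum is at most the sum
of Corollary 3.6 (i) (tree: `Literature.NumberTheory.LFunctions.SiegelZero.excPrimes`).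
[cite: TaoTeravainen2021, Corollary 3.6 (first bound), applied in the proof of (5.9)] -/
theorem sum_inv_excPrimes_le (x : ℕ) {R R₀ : ℝ} (hR₀ : R₀ ≤ Real.sqrt (2 * x)) :
    ∑ p ∈ (Finset.range (x + 1)).filter (fun p : ℕ =>
        p.Prime ∧ realChar χ p ≠ -1 ∧ Real.sqrt (2 * x) < (p : ℝ) ∧ (p : ℝ) ≤ 2 * x / Real.sqrt R),
      (1 : ℝ) / p ≤
    ∑ p ∈ Literature.NumberTheory.LFunctions.SiegelZero.excPrimes χ (Icc ⌈R₀⌉₊ ⌊(x : ℝ)⌋₊),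
      (1 : ℝ) / p := by
  refine Finset.sum_le_sum_of_subset_of_nonneg (fun p hp => ?_) fun _ _ _ => by positivity
  rw [Finset.mem_filter, Finset.mem_range] at hp
  obtain ⟨hpx, hpp, hre, hsq, -⟩ := hp
  rw [Literature.NumberTheory.LFunctions.SiegelZero.mem_excPrimes, Finset.mem_Icc, Nat.floor_natCast]
  refine ⟨⟨Nat.ceil_le.mpr (hR₀.trans hsq.le), Nat.le_of_lt_succ hpx⟩, hpp, fun h => hre ?_⟩
  simp [realChar, h]

/-- The number of `p* ≤ 2x/R^{1/2}` is at most `2x/R^{1/2} + 1`. [folklore] -/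
theorem card_excPrimes_le (x : ℕ) {R : ℝ} (hR : 0 < R) :
    (#((Finset.range (x + 1)).filter (fun p : ℕ =>
        p.Prime ∧ realChar χ p ≠ -1 ∧ Real.sqrt (2 * x) < (p : ℝ) ∧ (p : ℝ) ≤ 2 * x / Real.sqrt R)) : ℝ)
      ≤ 2 * x / Real.sqrt R + 1 := by
  have h0 : 0 ≤ 2 * x / Real.sqrt R := by positivity
  have hsub : (Finset.range (x + 1)).filter (fun p : ℕ =>
      p.Prime ∧ realChar χ p ≠ -1 ∧ Real.sqrt (2 * x) < (p : ℝ) ∧ (p : ℝ) ≤ 2 * x / Real.sqrt R) ⊆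
      Finset.range (⌊2 * x / Real.sqrt R⌋₊ + 1) := by
    intro p hp
    rw [Finset.mem_filter] at hp
    rw [Finset.mem_range, Nat.lt_succ_iff]
    exact Nat.le_floor hp.2.2.2.2
  calc (#((Finset.range (x + 1)).filter (fun p : ℕ =>
        p.Prime ∧ realChar χ p ≠ -1 ∧ Real.sqrt (2 * x) < (p : ℝ) ∧ (p : ℝ) ≤ 2 * x / Real.sqrt R)) : ℝ)
      ≤ #(Finset.range (⌊2 * x / Real.sqrt R⌋₊ + 1)) := by exact_mod_cast Finset.card_le_card hsub
    _ = (⌊2 * x / Real.sqrt R⌋₊ : ℝ) + 1 := by rw [Finset.card_range]; push_cast; ring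
    _ ≤ 2 * x / Real.sqrt R + 1 := by linarith [Nat.floor_le h0]


/-! ### The counting problem (5.10): sum over the exceptional primes -/

/-- **(5.10), the count**: with `Q` the exceptional primes `p* ≤ x`, `√(2x) < p* ≤ 2x/R^{1/2}`,
`3 ≤ z ≤ √(2x)`, `z² ≤ R`, `h₁ ≡ h₂ (mod 2)`:
`∑_{p* ∈ Q} #{n ≤ x : p* ∣ n+h₁, n+h₁, n+h₂ rough} ≤ (1 + C_Ω) x (4^{|h₁-h₂|} C₀²/log² z) ∑_{p* ∈ Q} 1/p*
 + #Q · z e⁸ log² z` ("Making the change of variables `n = p* n' - h₁` and using Lemma 3.2 and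
Mertens' theorem (3.5), we see that `𝔼_{n ≤ x} 1_{p*|n+h₁} ∏_j 1_{(≥R^{1/4})}(n+h_j) ≪ 1/(p* log^k R)`").
[cite: TaoTeravainen2021, §5 (proof of (5.9), display after (5.10))] -/
theorem sum_card_rough_pair_le {x h₁ h₂ : ℕ} (hne : h₁ ≠ h₂) (hpar : h₁ % 2 = h₂ % 2)
    {R z : ℝ} (hz : 3 ≤ z) (hzx : z ≤ Real.sqrt (2 * x)) (hzR : z ^ 2 ≤ R) :
    ∑ p ∈ (Finset.range (x + 1)).filter (fun p : ℕ =>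
        p.Prime ∧ realChar χ p ≠ -1 ∧ Real.sqrt (2 * x) < (p : ℝ) ∧ (p : ℝ) ≤ 2 * x / Real.sqrt R),
      (#((Icc 1 x).filter fun n : ℕ =>
          p ∣ n + h₁ ∧ IsRough R (n + h₁) ∧ IsRough R (n + h₂)) : ℝ) ≤
      (1 + Literature.NumberTheory.Sieve.SieveSequence.flConst 2
          (2 * Real.exp (17 + 12 / Real.log 2))) * x *
          (4 ^ (Int.natAbs ((h₁ : ℤ) - h₂)) * (4 * Real.exp (6 / Real.log 2) * Real.log 2) ^ 2 /
            Real.log z ^ 2) *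
          ∑ p ∈ (Finset.range (x + 1)).filter (fun p : ℕ =>
              p.Prime ∧ realChar χ p ≠ -1 ∧ Real.sqrt (2 * x) < (p : ℝ) ∧
                (p : ℝ) ≤ 2 * x / Real.sqrt R), (1 : ℝ) / p +
        #((Finset.range (x + 1)).filter (fun p : ℕ =>
            p.Prime ∧ realChar χ p ≠ -1 ∧ Real.sqrt (2 * x) < (p : ℝ) ∧
              (p : ℝ) ≤ 2 * x / Real.sqrt R)) * (z * (Real.exp 8 * Real.log z ^ 2)) := by
  set Q := (Finset.range (x + 1)).filter (fun p : ℕ =>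
      p.Prime ∧ realChar χ p ≠ -1 ∧ Real.sqrt (2 * x) < (p : ℝ) ∧ (p : ℝ) ≤ 2 * x / Real.sqrt R)
    with hQdef
  set Cω : ℝ := Literature.NumberTheory.Sieve.SieveSequence.flConst 2
      (2 * Real.exp (17 + 12 / Real.log 2)) with hCω
  set V : ℝ := ∏ p ∈ Nat.primesBelow ⌈z⌉₊,
      (1 - (Literature.NumberTheory.Sieve.polyRootCountMod ![pairPoly h₁ h₂] p : ℝ) / p) with hVdef
  set CV : ℝ := 4 ^ (Int.natAbs ((h₁ : ℤ) - h₂)) * (4 * Real.exp (6 / Real.log 2) * Real.log 2) ^ 2 /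
      Real.log z ^ 2 with hCVdef
  have hCω0 : 0 < Cω :=
    Literature.NumberTheory.Sieve.SieveSequence.flConst_pos (by norm_num) (by positivity)
  have hV : V ≤ CV := prod_one_sub_rootCount_pairPoly_le hne hz
  have hz2 : (2 : ℝ) ≤ z := by linarith
  -- per prime
  have hper : ∀ p ∈ Q, (#((Icc 1 x).filter fun n : ℕ =>
      p ∣ n + h₁ ∧ IsRough R (n + h₁) ∧ IsRough R (n + h₂)) : ℝ) ≤
        (1 + Cω) * x * CV * ((1 : ℝ) / p) + z * (Real.exp 8 * Real.log z ^ 2) := by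
    intro p hp
    rw [hQdef, Finset.mem_filter] at hp
    obtain ⟨-, hpp, -, hpsq, -⟩ := hp
    have hzp : z ≤ p := hzx.trans hpsq.le
    have h1 := card_filter_rough_pair_le (x := x) hpp hpar hz2 hzp hzR
    have hp0 : (0 : ℝ) < p := by exact_mod_cast hpp.pos
    have hxp : 0 ≤ (x : ℝ) / p := by positivity
    calc (#((Icc 1 x).filter fun n : ℕ => p ∣ n + h₁ ∧ IsRough R (n + h₁) ∧ IsRough R (n + h₂)) : ℝ)
        ≤ (1 + Cω) * ((x : ℝ) / p) * V + z * (Real.exp 8 * Real.log z ^ 2) := h1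
      _ ≤ (1 + Cω) * ((x : ℝ) / p) * CV + z * (Real.exp 8 * Real.log z ^ 2) := by
          gcongr
      _ = (1 + Cω) * x * CV * ((1 : ℝ) / p) + z * (Real.exp 8 * Real.log z ^ 2) := by ring
  calc ∑ p ∈ Q, (#((Icc 1 x).filter fun n : ℕ =>
          p ∣ n + h₁ ∧ IsRough R (n + h₁) ∧ IsRough R (n + h₂)) : ℝ)
      ≤ ∑ p ∈ Q, ((1 + Cω) * x * CV * ((1 : ℝ) / p) + z * (Real.exp 8 * Real.log z ^ 2)) :=
        Finset.sum_le_sum hper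
    _ = (1 + Cω) * x * CV * ∑ p ∈ Q, (1 : ℝ) / p + #Q * (z * (Real.exp 8 * Real.log z ^ 2)) := by
        rw [Finset.sum_add_distrib, ← Finset.mul_sum, Finset.sum_const, nsmul_eq_mul]

/-! ### Two numerical inequalities -/

/-- `t⁴ e^{-3t/10} ≤ 120 (10/3)⁵ / t` for `t > 0` (from `e^y ≥ y⁵/5!`). [folklore] -/
theorem pow_four_mul_exp_neg_le {t : ℝ} (ht : 0 < t) :
    t ^ 4 * Real.exp (-(3 / 10 * t)) ≤ 120 * (10 / 3) ^ 5 / t := by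
  have hy : 0 ≤ 3 / 10 * t := by positivity
  have h1 := @Real.pow_div_factorial_le_exp (3 / 10 * t) hy 5
  rw [show ((Nat.factorial 5 : ℕ) : ℝ) = 120 by norm_num [Nat.factorial]] at h1
  rw [Real.exp_neg, le_div_iff₀ ht]
  have hexp : 0 < Real.exp (3 / 10 * t) := Real.exp_pos _
  rw [div_le_iff₀ (by norm_num : (0 : ℝ) < 120)] at h1
  -- `t⁵ (3/10)⁵ ≤ 120 e^{3t/10}`
  have h2 : t ^ 4 * (Real.exp (3 / 10 * t))⁻¹ * t = t ^ 5 / Real.exp (3 / 10 * t) := by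
    rw [div_eq_mul_inv]
    ring
  rw [h2, div_le_iff₀ hexp]
  have h3 : (3 / 10 * t) ^ 5 = (3 / 10) ^ 5 * t ^ 5 := by ring
  rw [h3] at h1
  have h4 : (120 : ℝ) * (10 / 3) ^ 5 * Real.exp (3 / 10 * t) =
      (10 / 3) ^ 5 * (Real.exp (3 / 10 * t) * 120) := by ring
  rw [h4]
  have h5 : t ^ 5 = (10 / 3 : ℝ) ^ 5 * ((3 / 10) ^ 5 * t ^ 5) := by ring
  rw [h5]
  exact mul_le_mul_of_nonneg_left h1 (by positivity)

/-- `ℓ⁵ ≤ e^{ℓ¹⁰/2}` (`e^y ≥ 1 + y` and `1 + ℓ¹⁰/2 - ℓ⁵ = ((ℓ⁵ - 1)² + 1)/2 ≥ 0`). [folklore] -/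
theorem pow_five_le_exp (ℓ : ℝ) : ℓ ^ 5 ≤ Real.exp (ℓ ^ 10 / 2) := by
  have h1 := Real.add_one_le_exp (ℓ ^ 10 / 2)
  nlinarith [sq_nonneg (ℓ ^ 5 - 1)]

end TaoTeravainen

/-! ### (5.9) at `k = 2`, `ℓ = 0` -/

set_option maxHeartbeats 4000000 in
open TaoTeravainen in
/-- **Tao–Teräväinen 2022, (5.9) for `k = 2`, `ℓ = 0` — PROVED** (`TaoTeravainen2021_eq59_pair`):
"`𝔼_{n ≤ x} G(n+h₁) ∏_{j=2}^k (Λν + G)(n+h_j) ≈ 0`", i.e. for fixed distinct shifts `h₁, h₂ ≥ 1`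
and a fixed cutoff `ψ` there are (`ε₁ = 1` and, for every `0 < ε₀ ≤ ε₁`) `C`, `η₁` with
`𝔼_{n ≤ x} G(n+h₁)(Λν + G)(n+h₂) ≤ C / log^{1/20} η` for every Siegel zero of quality `η ≥ η₁` and
all `x` in the range (1.7). Proof as printed (reduction to (5.10), Lemma 3.2 with Mertens for the
pair `(n+h₁)(n+h₂)` on the progression `n ≡ -h₁ (mod p*)`, Corollary 3.6 (i), the scales (2.3)
and Siegel's bound (1.4)); see the module docstring for the bookkeeping and the constants
`C = C₁ + C₂`, `C₁ = 200 (1+B)⁴ (1+C_Ω) 4^{|h₁-h₂|} C₀² max(K,0)`,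
`C₂ = 120 (10/3)⁵ e⁸ (1+B)⁴ (1 + |log C_S|)`.
[cite: TaoTeravainen2021, §5, proof of Proposition 5.2, (5.9)–(5.10); Lemma 3.2, (3.5), Corollary 3.6, (2.3), (1.4)] -/
theorem TaoTeravainen2021_eq59_pair_holds : TaoTeravainen2021_eq59_pair := by
  intro h₁ h₂ hh₁ hh₂ hne ψ hψ
  refine ⟨1, one_pos, fun ε₀ hε₀ _ => ?_⟩
  obtain ⟨B, hB0, hB⟩ := hψ.exists_abs_le
  obtain ⟨CS, hCS, hSiegel⟩ := exists_siegelZero_quality_le one_pos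
  obtain ⟨K₃₆, η₀, h36⟩ :=
    Literature.NumberTheory.LFunctions.SiegelZero.TaoTeravainen2021_cor36_i_holds 1 one_pos
  -- constants
  set K : ℝ := (1 + B) ^ 2 with hKdef
  set Cω : ℝ := Literature.NumberTheory.Sieve.SieveSequence.flConst 2
    (2 * Real.exp (17 + 12 / Real.log 2)) with hCωdef
  set CV₀ : ℝ := 4 ^ (Int.natAbs ((h₁ : ℤ) - h₂)) *
    (4 * Real.exp (6 / Real.log 2) * Real.log 2) ^ 2 with hCV₀def
  set K' : ℝ := max K₃₆ 0 with hK'def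
  set cS : ℝ := 1 + |Real.log CS| with hcSdef
  set M : ℝ := 10 * cS + 10 with hMdef
  set C₁ : ℝ := 200 * K ^ 2 * (1 + Cω) * CV₀ * K' with hC₁def
  set C₂ : ℝ := 120 * (10 / 3) ^ 5 * Real.exp 8 * K ^ 2 * cS with hC₂def
  have hCω0 : 0 < Cω :=
    Literature.NumberTheory.Sieve.SieveSequence.flConst_pos (by norm_num) (by positivity)
  have hK0 : 0 ≤ K := sq_nonneg _
  have hCV₀0 : 0 ≤ CV₀ := by positivity
  have hK'0 : 0 ≤ K' := le_max_right _ _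
  have hcS1 : 1 ≤ cS := by
    have := abs_nonneg (Real.log CS)
    rw [hcSdef]
    linarith
  have hcS0 : 0 < cS := by linarith
  have hM10 : 10 ≤ M := by rw [hMdef]; linarith
  have hM0 : 0 ≤ M := by linarith
  have hC₁0 : 0 ≤ C₁ := by positivity
  have hC₂0 : 0 ≤ C₂ := by positivity
  refine ⟨C₁ + C₂, max (max η₀ (Real.exp 1024)) (max (Real.exp (M ^ 20)) (CS * max h₁ h₂)), ?_⟩
  intro q _ χ η hS hη x hxlo hxhi
  -- thresholds
  have hη₀ : η₀ ≤ η := le_trans ((le_max_left _ _).trans (le_max_left _ _)) hη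
  have hη1024 : Real.exp 1024 ≤ η := le_trans ((le_max_right _ _).trans (le_max_left _ _)) hη
  have hηM : Real.exp (M ^ 20) ≤ η := le_trans ((le_max_left _ _).trans (le_max_right _ _)) hη
  have hηh : CS * ((max h₁ h₂ : ℕ) : ℝ) ≤ η :=
    le_trans ((le_max_right _ _).trans (le_max_right _ _)) hη
  -- sizes of `η`, `q`, `x`
  have hη0 : 0 < η := (Real.exp_pos _).trans_le hη1024
  have hlogη : 1024 ≤ Real.log η := by
    rw [← Real.log_exp 1024]
    exact Real.log_le_log (Real.exp_pos _) hη1024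
  have hlogη0 : 0 < Real.log η := by linarith
  have hq3 : (3 : ℝ) ≤ q := by exact_mod_cast hS.three_le
  have hqx : (q : ℝ) ≤ x :=
    calc (q : ℝ) = (q : ℝ) ^ (1 : ℝ) := (Real.rpow_one _).symm
      _ ≤ (q : ℝ) ^ ((41 : ℝ) / 2 + ε₀) :=
          Real.rpow_le_rpow_of_exponent_le (by linarith) (by linarith)
      _ ≤ x := hxlo
  have hx3 : (3 : ℝ) ≤ x := hq3.trans hqx
  have hx1 : (1 : ℝ) ≤ x := by linarith
  have hx0 : (0 : ℝ) < x := by linarith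
  -- `η ≤ C_S q ≤ C_S x` ((1.4)), so `x ≥ h₁, h₂`
  have hηx : η ≤ CS * x := by
    have h1 := hSiegel q χ η hS
    rw [Real.rpow_one] at h1
    exact h1.trans (mul_le_mul_of_nonneg_left hqx hCS.le)
  have hhx : ((max h₁ h₂ : ℕ) : ℝ) ≤ x := le_of_mul_le_mul_left (hηh.trans hηx) hCS
  have hhx' : max h₁ h₂ ≤ x := by exact_mod_cast hhx
  have hh₁x : h₁ ≤ x := (le_max_left h₁ h₂).trans hhx'
  have hh₂x : h₂ ≤ x := (le_max_right h₁ h₂).trans hhx'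
  -- `u = log x ≥ 1`, `ℓ = log^{1/20} η ≥ M`
  set u : ℝ := Real.log x with hudef
  have hu1 : 1 ≤ u := (Real.le_log_iff_exp_le hx0).mpr (by linarith [Real.exp_one_lt_d9])
  have hu0 : 0 < u := by linarith
  set ℓ : ℝ := Real.log η ^ ((1 : ℝ) / 20) with hℓdef
  have hℓ0 : 0 < ℓ := Real.rpow_pos_of_pos hlogη0 _
  have hℓ20 : ℓ ^ 20 = Real.log η := by
    rw [hℓdef, ← Real.rpow_natCast, ← Real.rpow_mul hlogη0.le]
    norm_num
  have hℓ2 : ℓ ^ 2 = Real.log η ^ ((1 : ℝ) / 10) := by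
    rw [hℓdef, ← Real.rpow_natCast, ← Real.rpow_mul hlogη0.le]
    norm_num
  have hℓ10 : ℓ ^ 10 = Real.sqrt (Real.log η) := by
    rw [hℓdef, ← Real.rpow_natCast, ← Real.rpow_mul hlogη0.le, Real.sqrt_eq_rpow]
    norm_num
  have hℓM : M ≤ ℓ := by
    have h1 : M ^ 20 ≤ Real.log η := by
      rw [← Real.log_exp (M ^ 20)]
      exact Real.log_le_log (Real.exp_pos _) hηM
    have h2 : (M ^ 20) ^ ((1 : ℝ) / 20) ≤ ℓ := Real.rpow_le_rpow (by positivity) h1 (by norm_num)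
    rwa [← Real.rpow_natCast, ← Real.rpow_mul hM0, show ((20 : ℕ) : ℝ) * (1 / 20) = 1 by norm_num,
      Real.rpow_one] at h2
  have hℓ1 : 1 ≤ ℓ := by linarith
  -- `log η ≤ c_S u`
  have hlogη_le : Real.log η ≤ cS * u := by
    have h1 : Real.log η ≤ Real.log CS + u := by
      rw [hudef, ← Real.log_mul hCS.ne' hx0.ne']
      exact Real.log_le_log hη0 hηx
    have h2 : Real.log CS ≤ |Real.log CS| * u :=
      (le_abs_self _).trans (le_mul_of_one_le_right (abs_nonneg _) hu1)
    rw [hcSdef]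
    linarith
  -- `R = e^t`, `t = u/ℓ² = log R`
  set R : ℝ := pairScaleR η x with hRdef
  set t : ℝ := u / ℓ ^ 2 with htdef
  have hℓ2pos : 0 < ℓ ^ 2 := by positivity
  have ht0 : 0 < t := div_pos hu0 hℓ2pos
  have hut : u = t * ℓ ^ 2 := by
    rw [htdef]
    field_simp
  have hRexp : R = Real.exp t := by
    rw [hRdef]
    unfold pairScaleR
    rw [← hℓ2, Real.rpow_def_of_pos hx0, htdef, hudef]
    congr 1
    ring
  -- `t ≥ ℓ¹⁸/c_S ≥ 10`
  have ht_ge : ℓ ^ 18 ≤ cS * t := by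
    have h1 : ℓ ^ 18 * ℓ ^ 2 ≤ cS * t * ℓ ^ 2 := by
      have : ℓ ^ 18 * ℓ ^ 2 = Real.log η := by rw [← hℓ20]; ring
      rw [this, mul_assoc, ← hut]
      exact hlogη_le
    exact le_of_mul_le_mul_right h1 hℓ2pos
  have hℓ18 : ℓ ≤ ℓ ^ 18 := le_self_pow₀ hℓ1 (by norm_num)
  have ht10 : 10 ≤ t := by
    have h1 : cS * 10 ≤ cS * t := by
      have : 10 * cS ≤ ℓ := by rw [hMdef] at hℓM; linarith
      linarith
    exact le_of_mul_le_mul_left h1 hcS0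
  have hR1 : 1 < R := by
    rw [hRexp]
    linarith [Real.add_one_le_exp t]
  have hR0 : 0 < R := by linarith
  have hRsqrt : R ≤ Real.sqrt x := pairScaleR_le_sqrt hη1024 hx1
  have hsqrt_le : Real.sqrt x ≤ x := by
    have h1 : Real.sqrt x ≤ Real.sqrt ((x : ℝ) ^ 2) := Real.sqrt_le_sqrt (by nlinarith)
    rwa [Real.sqrt_sq hx0.le] at h1
  have hRx : R ≤ x := hRsqrt.trans hsqrt_le
  have hR2x : R ≤ 2 * x := by linarith
  have hsqrtR : Real.sqrt R = Real.exp (t / 2) := by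
    rw [hRexp, show Real.exp t = Real.exp (t / 2) ^ 2 by
      rw [← Real.exp_nat_mul]; congr 1; push_cast; ring]
    exact Real.sqrt_sq (Real.exp_pos _).le
  -- `z = R^{1/5} = e^{t/5}`
  set z : ℝ := Real.exp (t / 5) with hzdef
  have hz0 : 0 < z := Real.exp_pos _
  have hz3 : 3 ≤ z := by
    rw [hzdef]
    linarith [Real.add_one_le_exp (t / 5)]
  have hlogz : Real.log z = t / 5 := Real.log_exp _
  have hz_sq_R : z ^ 2 ≤ R := by
    rw [hzdef, hRexp, ← Real.exp_nat_mul]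
    exact Real.exp_le_exp.mpr (by push_cast; linarith)
  have hz_le : z ≤ Real.sqrt (2 * x) := by
    rw [Real.le_sqrt' hz0]
    linarith
  have hzR : z / Real.sqrt R = Real.exp (-(3 / 10 * t)) := by
    rw [hzdef, hsqrtR, ← Real.exp_sub]
    congr 1
    ring
  -- Step 1: the reduction to the count `T`
  set Q := (Finset.range (x + 1)).filter (fun p : ℕ =>
      p.Prime ∧ realChar χ p ≠ -1 ∧ Real.sqrt (2 * x) < (p : ℝ) ∧ (p : ℝ) ≤ 2 * x / Real.sqrt R)
    with hQdef
  set T : ℝ := ∑ p ∈ Q, (#((Icc 1 x).filter fun n : ℕ =>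
      p ∣ n + h₁ ∧ IsRough R (n + h₁) ∧ IsRough R (n + h₂)) : ℝ) with hTdef
  have hT0 : 0 ≤ T := Finset.sum_nonneg fun p _ => Nat.cast_nonneg _
  have hSle := sum_errG_mul_le χ hψ hB hR1 (h₁ := h₁) (h₂ := h₂) hR2x hh₁x hh₂x
  set L : ℝ := Real.log (2 * x) with hLdef
  have hL : L ≤ 2 * u := by
    rw [hLdef, hudef, Real.log_mul (by norm_num) hx0.ne']
    have : Real.log 2 ≤ Real.log x := Real.log_le_log (by norm_num) (by linarith)
    linarith
  have hL0 : 0 ≤ L := Real.log_nonneg (by linarith)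
  -- `S ≤ 8 K² u² T`
  have hS8 : ∑ n ∈ Icc 1 x, pairErrG χ ψ η x (n + h₁) *
      (sievedVonMangoldt ψ (pairScaleR η x) (n + h₂) + pairErrG χ ψ η x (n + h₂)) ≤
        8 * K ^ 2 * u ^ 2 * T := by
    calc ∑ n ∈ Icc 1 x, pairErrG χ ψ η x (n + h₁) *
          (sievedVonMangoldt ψ (pairScaleR η x) (n + h₂) + pairErrG χ ψ η x (n + h₂))
        ≤ 2 * ((1 + B) ^ 2 * Real.log (2 * x)) ^ 2 * T := hSle
      _ = 2 * K ^ 2 * L ^ 2 * T := by rw [hKdef, hLdef]; ring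
      _ ≤ 2 * K ^ 2 * (2 * u) ^ 2 * T :=
          mul_le_mul_of_nonneg_right
            (mul_le_mul_of_nonneg_left (pow_le_pow_left₀ hL0 hL 2) (by positivity)) hT0
      _ = 8 * K ^ 2 * u ^ 2 * T := by ring
  -- the goal
  rw [div_le_iff₀ hx0]
  have hgoalℓ : (C₁ + C₂) / Real.log η ^ ((1 : ℝ) / 20) * x = (C₁ + C₂) * x / ℓ := by
    rw [hℓdef]
    ring
  rw [hgoalℓ]
  by_cases hpar : h₁ % 2 = h₂ % 2
  · -- Step 2: the count
    have hT := sum_card_rough_pair_le χ hne hpar hz3 hz_le hz_sq_R (x := x) (R := R)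
    have hSig : ∑ p ∈ Q, (1 : ℝ) / p ≤ K' * Real.exp (-(ℓ ^ 10) / 2) := by
      have hR₀ : (x : ℝ) ^ (1 / Real.sqrt (Real.log η)) ≤ Real.sqrt (2 * x) := by
        have h1 : (x : ℝ) ^ (1 / Real.sqrt (Real.log η)) ≤ (x : ℝ) ^ ((1 : ℝ) / 2) := by
          refine Real.rpow_le_rpow_of_exponent_le hx1 ?_
          rw [← hℓ10]
          have : (2 : ℝ) ≤ ℓ ^ 10 := by
            have := le_self_pow₀ hℓ1 (show 10 ≠ 0 by norm_num)
            linarith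
          exact one_div_le_one_div_of_le two_pos this
        rw [← Real.sqrt_eq_rpow] at h1
        exact h1.trans (Real.sqrt_le_sqrt (by linarith))
      have h1 := sum_inv_excPrimes_le χ x hR₀ (R := R)
      have h2 := h36 q χ hS.1 hS.2.1 η hη₀ hS.2.2.2 (x : ℝ)
        (by rw [show ((1 : ℝ) + 1) / 2 = 1 by norm_num, Real.rpow_one]; exact hqx) hxhi
      calc ∑ p ∈ Q, (1 : ℝ) / p ≤ _ := h1
        _ ≤ K₃₆ * Real.exp (-Real.sqrt (Real.log η) / 2) := h2
        _ ≤ K' * Real.exp (-(ℓ ^ 10) / 2) := by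
            rw [← hℓ10]
            exact mul_le_mul_of_nonneg_right (le_max_left _ _) (Real.exp_pos _).le
    have hSig0 : 0 ≤ ∑ p ∈ Q, (1 : ℝ) / p := Finset.sum_nonneg fun p _ => by positivity
    have hQcard := card_excPrimes_le χ x hR0
    have hQ3 : (#Q : ℝ) ≤ 3 * x / Real.sqrt R := by
      have hsR : 0 < Real.sqrt R := Real.sqrt_pos.mpr hR0
      have h1 : 1 ≤ (x : ℝ) / Real.sqrt R := by
        rw [le_div_iff₀ hsR, one_mul]
        exact (Real.sqrt_le_sqrt hRx).trans hsqrt_le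
      calc (#Q : ℝ) ≤ 2 * x / Real.sqrt R + 1 := hQcard
        _ ≤ 2 * x / Real.sqrt R + x / Real.sqrt R := by linarith
        _ = 3 * x / Real.sqrt R := by ring
    -- main term
    have hmain : 8 * K ^ 2 * u ^ 2 * ((1 + Cω) * x * (CV₀ / Real.log z ^ 2) *
        ∑ p ∈ Q, (1 : ℝ) / p) ≤ C₁ * x / ℓ := by
      rw [hlogz, hut]
      have h1 : 8 * K ^ 2 * (t * ℓ ^ 2) ^ 2 * ((1 + Cω) * x * (CV₀ / (t / 5) ^ 2) *
          ∑ p ∈ Q, (1 : ℝ) / p) = 200 * K ^ 2 * (1 + Cω) * CV₀ * x * ℓ ^ 4 *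
            ∑ p ∈ Q, (1 : ℝ) / p := by
        field_simp
        ring
      rw [h1]
      have h5 : ℓ ^ 5 * Real.exp (-(ℓ ^ 10) / 2) ≤ 1 := by
        have h := pow_five_le_exp ℓ
        have hpos : 0 < Real.exp (ℓ ^ 10 / 2) := Real.exp_pos _
        rw [show -(ℓ ^ 10) / 2 = -(ℓ ^ 10 / 2) by ring, Real.exp_neg]
        rw [← div_eq_mul_inv, div_le_one hpos]
        exact h
      rw [le_div_iff₀ hℓ0]
      calc 200 * K ^ 2 * (1 + Cω) * CV₀ * x * ℓ ^ 4 * (∑ p ∈ Q, (1 : ℝ) / p) * ℓ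
          ≤ 200 * K ^ 2 * (1 + Cω) * CV₀ * x * ℓ ^ 4 * (K' * Real.exp (-(ℓ ^ 10) / 2)) * ℓ := by
            gcongr
        _ = 200 * K ^ 2 * (1 + Cω) * CV₀ * K' * x * (ℓ ^ 5 * Real.exp (-(ℓ ^ 10) / 2)) := by ring
        _ ≤ 200 * K ^ 2 * (1 + Cω) * CV₀ * K' * x * 1 := by
            refine mul_le_mul_of_nonneg_left h5 ?_
            positivity
        _ = C₁ * x := by rw [hC₁def]; ring
    -- error term
    have herr : 8 * K ^ 2 * u ^ 2 * (#Q * (z * (Real.exp 8 * Real.log z ^ 2))) ≤ C₂ * x / ℓ := by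
      rw [hlogz, hut]
      have hsR : 0 < Real.sqrt R := Real.sqrt_pos.mpr hR0
      have h1 : 8 * K ^ 2 * (t * ℓ ^ 2) ^ 2 * (#Q * (z * (Real.exp 8 * (t / 5) ^ 2))) ≤
          8 * K ^ 2 * (t * ℓ ^ 2) ^ 2 * ((3 * x / Real.sqrt R) * (z * (Real.exp 8 * (t / 5) ^ 2))) := by
        gcongr
      refine h1.trans ?_
      have h2 : 8 * K ^ 2 * (t * ℓ ^ 2) ^ 2 * ((3 * x / Real.sqrt R) * (z * (Real.exp 8 * (t / 5) ^ 2))) =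
          (24 / 25) * Real.exp 8 * K ^ 2 * x * ℓ ^ 4 * (t ^ 4 * (z / Real.sqrt R)) := by
        field_simp
        ring
      rw [h2, hzR]
      have h3 := pow_four_mul_exp_neg_le ht0
      -- `1/t ≤ c_S/ℓ¹⁸`
      have h4 : 120 * (10 / 3 : ℝ) ^ 5 / t ≤ 120 * (10 / 3) ^ 5 * cS / ℓ ^ 18 := by
        rw [div_le_div_iff₀ ht0 (by positivity)]
        have h0 : (0 : ℝ) ≤ 120 * (10 / 3) ^ 5 := by positivity
        calc 120 * (10 / 3 : ℝ) ^ 5 * ℓ ^ 18 ≤ 120 * (10 / 3) ^ 5 * (cS * t) :=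
              mul_le_mul_of_nonneg_left ht_ge h0
          _ = 120 * (10 / 3) ^ 5 * cS * t := by ring
      have hℓ14 : ℓ ≤ ℓ ^ 14 := le_self_pow₀ hℓ1 (by norm_num)
      rw [le_div_iff₀ hℓ0]
      calc (24 / 25) * Real.exp 8 * K ^ 2 * x * ℓ ^ 4 * (t ^ 4 * Real.exp (-(3 / 10 * t))) * ℓ
          ≤ 1 * Real.exp 8 * K ^ 2 * x * ℓ ^ 4 * (120 * (10 / 3) ^ 5 * cS / ℓ ^ 18) * ℓ := by
            gcongr
            · norm_num
            · exact h3.trans h4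
        _ = 120 * (10 / 3) ^ 5 * Real.exp 8 * K ^ 2 * cS * x * (ℓ / ℓ ^ 14) := by
            field_simp
        _ ≤ 120 * (10 / 3) ^ 5 * Real.exp 8 * K ^ 2 * cS * x * 1 := by
            refine mul_le_mul_of_nonneg_left ?_ (by positivity)
            rw [div_le_one (by positivity)]
            exact hℓ14
        _ = C₂ * x := by rw [hC₂def]; ring
    -- assemble
    calc ∑ n ∈ Icc 1 x, pairErrG χ ψ η x (n + h₁) *
          (sievedVonMangoldt ψ (pairScaleR η x) (n + h₂) + pairErrG χ ψ η x (n + h₂))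
        ≤ 8 * K ^ 2 * u ^ 2 * T := hS8
      _ ≤ 8 * K ^ 2 * u ^ 2 * ((1 + Cω) * x * (CV₀ / Real.log z ^ 2) * ∑ p ∈ Q, (1 : ℝ) / p +
            #Q * (z * (Real.exp 8 * Real.log z ^ 2))) :=
          mul_le_mul_of_nonneg_left hT (by positivity)
      _ = 8 * K ^ 2 * u ^ 2 * ((1 + Cω) * x * (CV₀ / Real.log z ^ 2) * ∑ p ∈ Q, (1 : ℝ) / p) +
            8 * K ^ 2 * u ^ 2 * (#Q * (z * (Real.exp 8 * Real.log z ^ 2))) := by ring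
      _ ≤ C₁ * x / ℓ + C₂ * x / ℓ := add_le_add hmain herr
      _ = (C₁ + C₂) * x / ℓ := by ring
  · -- the odd case: every count vanishes
    have hR4 : 4 ≤ R := by
      rw [hRexp]
      linarith [Real.add_one_le_exp t]
    have hT0' : T = 0 := by
      rw [hTdef]
      refine Finset.sum_eq_zero fun p _ => ?_
      rw [card_filter_rough_pair_eq_zero hpar hR4, Nat.cast_zero]
    calc ∑ n ∈ Icc 1 x, pairErrG χ ψ η x (n + h₁) *
          (sievedVonMangoldt ψ (pairScaleR η x) (n + h₂) + pairErrG χ ψ η x (n + h₂))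
        ≤ 8 * K ^ 2 * u ^ 2 * T := hS8
      _ = 0 := by rw [hT0', mul_zero]
      _ ≤ (C₁ + C₂) * x / ℓ := by positivity

end Literature.Barriers.Parity
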